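import Summits.BirchSwinnertonDyer.BirchSwinnertonDyer.Theorems.EisensteinPrimesBSDpOnCellCTelescopeK2TwistedTateKummer
import Summits.BirchSwinnertonDyer.BirchSwinnertonDyer.Theorems.EisensteinPrimesBSDpOnCellCTelescopeK2FixedTorsionFiniteSplitMult
import Summits.BirchSwinnertonDyer.BirchSwinnertonDyer.Theorems.EisensteinPrimesSqrtGammaNonsplitFrobenius
import Summits.BirchSwinnertonDyer.Rank1Residual.X2.GreenbergVatsalStrictSelmerMultiplicative
import Literature.NumberTheory.EllipticCurves.SemistableReductionBaseChange
import Literature.NumberTheory.EllipticCurves.RibetGoodLatticeExistsProofs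
import HarnessLib

/-!
# Crux 4 `BSDpOnCellC` (stmt-BirchSwinnertonDyer-19034), line `telescope`, leaf N2 / sub-leaf W2: the inputs (hfinK) / (hfin𝔮) of the
# weight-two control AT ANY MULTIPLICATIVE `p`, split OR NON-SPLIT — «the `Gal(K̄_𝔮/K_{∞,𝔮})`-fixed `p`-power torsion of `E(K̄)` is finite»
# from the TWISTED Tate uniformisation, modulo «`μ_p ⊄ K_𝔮^{nr}`» (helper, `--supports stmt-BirchSwinnertonDyer-19034 --as helper`; closes nothing)

Cell `bsd-eis`, width seat `bsd-line-x2-p2` (prover g20, 2026-08-30; D-0154 KEY row 5). THEOREMS ONLY: no definition, no named fact,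
no `sorry`, no instance, no notation. The non-split twin (indeed a uniform version) of bsd-stepL's (L1)
`LocalTorsionDegreeOne.exists_submodule_finite_of_fixed_primaryTorsion` / width g19's
`TelescopeK2FixedTorsionFiniteSplitMult.finite_fixed_torsionBy_local_of_splitMult` (p748758), whose hypothesis
`W.HasSplitMultiplicativeReductionAtPrime p` is here weakened to `W.HasMultiplicativeReductionAtPrime p` (Cell C = `Mult`, both signs).

SETTING. `E = W/ℚ` elliptic with multiplicative reduction at the odd prime `p`; `K` a number field, `𝔮 ∋ p` a prime of degree one
(`K_𝔮 = ℚ_p`); `f : Γ_{K_𝔮} → ℤ_p` continuous with image `⊇ p^s ℤ_p` (the anticyclotomic character on the decomposition group), `H = ker f`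
(normal; `K̄_𝔮^H = K_{∞,𝔮}`, a `ℤ_p`-extension: every `H`-fixed element has `p`-power degree, tree
`TateTorsionRigidity.exists_natDegree_minpoly_eq_pow_of_fixed_ker`). THE ARGUMENT (Silverman *ATAEC* V.5.3–5.4 + Kummer theory): the tree's
PROVED twisted uniformisation `TateCurve.Silverman1994_thmV53_corV54_tateUniformisation_holds` at `𝔮` gives `Ψ : K̄_𝔮^× → E(K̄_𝔮)` onto with
kernel `q^ℤ` and `σ·Ψ(u) = χ(σ)Ψ(σu)`, `χ(σ) = ±1` according as `σ t = ± t`, `t² = γ = −c₄/c₆`. Let `P = Ψ(u)` be `H`-fixed with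
`p^n P = O`, so `u^{p^n} = q^m`.
* CASE B (`H` fixes `t`): `σu/u ∈ q^ℤ ∩ μ = 1` for `σ ∈ H`, so `u ∈ K̄_𝔮^H`; writing `q = r^{p^k}` with `r ∉ K_𝔮^p` (§1, valuation), the
  Kummer lemmas of bsd-stepL (`pow_prime_ne_algebraMap_of_fixed`, `mem_zpowers_of_pow_prime_pow_eq_zpow`: no `H`-fixed `p`-th root of `r`,
  `μ_p(K̄_𝔮^H) = 1`) give `u ∈ r^ℤ`, i.e. `P ∈ ℤ·Ψ(r)`, a finite group (`p^k Ψ(r) = Ψ(q) = O`).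
* CASE A (some `τ₀ ∈ H` has `τ₀ t = −t`): `Ψ(τ₀u · u) = O` gives `2m ∈ p^n ℤ`, so (p odd) `u = ζ q^{m'}` with `ζ^{p^n} = 1` and `P = Ψ(ζ)`;
  every `h ∈ H` fixing `t` fixes `ζ` (as in Case B); the inertia group `I` fixes `t` (tree `SqrtGammaNonsplitFrobenius.inertia_fix_sqrt_gamma`),
  and `I = I^{p-1}·(I ∩ H)` because `f(I) ⊆ ℤ_p` is closed, hence `(p−1)`-divisible (§2); as `σ^{p−1}` fixes every `p`-th root of unity
  (Fermat), a primitive `p`-th root of unity among the powers of `ζ` would be `I`-fixed — excluded by the hypothesis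
  (μ) «no primitive `p`-th root of unity of `K̄_𝔮` is fixed by the inertia group» (`ℚ_p(ζ_p)/ℚ_p` is ramified; Serre *Corps locaux* IV §4
  Prop. 17 — the tree has it for `ℚ_v`, `ModPCyclotomicCharacterInertiaSurjective`, not yet for `K_𝔮`; kept as an explicit hypothesis here).
  Hence `ζ = 1`, `P = O`.

* §1 `exists_pow_eq_and_forall_pow_ne` — `q = r^{p^k}` with `r ∉ K_𝔮^p` for `0 < |q|_𝔮 < 1`; `zpow_algebraMap_injective`.
* §2 `exists_eq_pow_mul_of_mem_absInertia` — `σ ∈ I ⇒ σ = σ₁^n · h`, `σ₁ ∈ I`, `h ∈ I ∩ ker f`, for `n` prime to `p`.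
* §3 **`finite_fixed_torsion_of_mult`** — THE FINITENESS on `E_K(K̄)` (Γ_K acting, restricted along `absGaloisRestrict K K_𝔮`), modulo (μ).
* §4 `exists_submodule_finite_of_fixed_primaryTorsion_of_mult` (the (L1) shape: a finite `ℤ_p`-submodule of `E_K[p^∞]` containing every fixed
  vector) and **`finite_fixed_torsionBy_local_of_mult`** / `…_global_of_mult` — p748758's (hfin𝔮)/(hfinK) with `hsplit` replaced by `hmult` + (μ).

HONEST FRAMING: assembly over tree theorems (twisted uniformisation, Kummer lemmas of bsd-stepL); hypothesis (μ) is classical but NOT proved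
here; nothing about any curve's BSD is proved; no registered stub, crux or summit statement is proved by this file; closes: none.

References: [SilvermanATAEC1994] Lemma V.5.2, Thm. V.5.3, Cor. V.5.4 (PDF pp. 406–410); [Castella2018Erratum] Lemma 2.1, Remark (2) (p. 2);
[GreenbergLNM1716] §4, proof of Prop. 4.10; [SerreLocalFields1979] Ch. IV §4 Prop. 17; [Washington1997] §13.1.
-/

noncomputable section

-- D-0017: single-problem summit, the namespace repeats the problem name by design.
set_option linter.dupNamespace false
set_option autoImplicit false

open scoped Classical
open Field IsDedekindDomain NumberField WeierstrassCurve
open Literature.NumberTheory.GaloisRepresentations Literature.NumberTheory.EllipticCurves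
  Literature.NumberTheory.EllipticCurves.BigGaloisRep

namespace Summit.BirchSwinnertonDyer.BirchSwinnertonDyer.Theorems.TelescopeK2FixedTorsionFiniteMult

open TelescopeK2TwistedTateKummer

variable {K : Type} [Field K] [NumberField K] {p : ℕ} [hp : Fact p.Prime]

/-! ## §4 The finiteness on `E_K(K̄)` at a multiplicative degree-one prime, modulo (μ) -/

/-- **THE `ker f`-FIXED `p`-POWER TORSION OF `E_K(K̄)` IS FINITE AT A MULTIPLICATIVE PRIME — split OR non-split.** `p` odd,
`E = W/ℚ` with multiplicative reduction at `p`, `K` a number field, `𝔮 ∋ p` of degree one, `f : Γ_{K_𝔮} → ℤ_p` continuous with image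
`⊇ p^s ℤ_p`, and (μ) no primitive `p`-th root of unity of `K̄_𝔮` is fixed by the inertia group `I_{K_𝔮}`: then the set of `P ∈ E_K(K̄)` of
`p`-power order fixed by `res τ` for all `τ ∈ ker f` (`res = absGaloisRestrict K K_𝔮`) is FINITE — it embeds (tree `pointsMap`, equivariant and
injective) into `ℤ·Ψ(r) ⊆ E(K̄_𝔮)`, `p^k Ψ(r) = O`, by §3 applied to the tree's twisted uniformisation at `𝔮`.
[cite: SilvermanATAEC1994, Thm. V.5.3, Cor. V.5.4 (PDF pp. 407–410)] [cite: Castella2018Erratum, Lemma 2.1, Remark (2) (p. 2)]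
[cite: GreenbergLNM1716, §4, proof of Prop. 4.10] -/
theorem finite_fixed_torsion_of_mult (W : WeierstrassCurve ℚ) [W.IsElliptic] (hp2 : p ≠ 2)
    (hmult : W.HasMultiplicativeReductionAtPrime p) (𝔮 : HeightOneSpectrum (𝓞 K)) (h𝔮 : ((p : ℕ) : 𝓞 K) ∈ 𝔮.asIdeal)
    (he : 𝔮.asIdeal.ramificationIdx (𝓞 ℚ) = 1) (hf : 𝔮.asIdeal.inertiaDeg (𝓞 ℚ) = 1)
    (f : absoluteGaloisGroup (𝔮.adicCompletion K) →ₜ* Multiplicative ℤ_[p]) {s : ℕ}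
    (hsurj : ∀ y : ℤ_[p], ∃ σ : absoluteGaloisGroup (𝔮.adicCompletion K), (f σ).toAdd = (p : ℤ_[p]) ^ s * y)
    (hμ : ∀ ζ : AlgebraicClosure (𝔮.adicCompletion K),
      (∀ σ ∈ absInertia (𝔮.adicCompletion K), σ • ζ = ζ) → ζ ^ p = 1 → ζ = 1) :
    {P : geomPoints (W.baseChange K) | (∃ n : ℕ, (p ^ n) • P = 0) ∧
      ∀ τ ∈ f.toMonoidHom.ker, absGaloisRestrict K (𝔮.adicCompletion K) τ • P = P}.Finite := by
  classical
  have hpP : p.Prime := hp.out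
  haveI : CharZero (𝔮.adicCompletion K) := charZero_of_injective_algebraMap (algebraMap K (𝔮.adicCompletion K)).injective
  haveI : (W.baseChange K).IsElliptic := by rw [WeierstrassCurve.baseChange]; infer_instance
  -- multiplicative reduction of `E_K` at `𝔮`
  let v : HeightOneSpectrum (𝓞 ℚ) := 𝔮.under (𝓞 ℚ)
  have hpv : ((p : ℕ) : 𝓞 ℚ) ∈ v.asIdeal := by
    change ((p : ℕ) : 𝓞 ℚ) ∈ 𝔮.asIdeal.comap (algebraMap (𝓞 ℚ) (𝓞 K))
    rw [Ideal.mem_comap, map_natCast]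
    exact h𝔮
  have hmultv : W.HasMultiplicativeReductionAt v :=
    Summit.BirchSwinnertonDyer.Rank1Residual.X2.GreenbergVatsalStrictSelmerMultiplicative.hasMultiplicativeReductionAt_of_mem
      W p hmult hpv
  haveI : 𝔮.asIdeal.LiesOver v.asIdeal := ⟨rfl⟩
  have hmult𝔮 : (W.baseChange K).HasMultiplicativeReductionAt 𝔮 :=
    W.hasMultiplicativeReductionAt_baseChange_of_liesOver K (v := v) (w := 𝔮) hmultv
  -- the twisted uniformisation at `𝔮`
  obtain ⟨q, t, Ψ, hq0, hq1, -, ht2, hΨsurj, hΨker, hΨσ, -⟩ :=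
    TateCurve.Silverman1994_thmV53_corV54_tateUniformisation_holds (W.baseChange K) 𝔮 hmult𝔮
  -- `H = ker f`: normal, `p`-power degrees, `μ_p(K̄_𝔮^H) = 1`
  set H : Subgroup (absoluteGaloisGroup (𝔮.adicCompletion K)) := f.toMonoidHom.ker with hH
  haveI : H.Normal := MonoidHom.normal_ker _
  obtain ⟨φ⟩ := LocalTorsionDegreeOne.nonempty_padic_ringEquiv_adicCompletion p K 𝔮 h𝔮 he hf
  have hμF : ∀ z : 𝔮.adicCompletion K, z ^ p = 1 → z = 1 := fun z hz => by
    have h1 : (φ.symm z) ^ p = 1 := by rw [← map_pow, hz, map_one]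
    have h2 := TatePrimeTorsion.eq_one_of_pow_prime_eq_one hp2 _ h1
    rw [← φ.apply_symm_apply z, h2, map_one]
  have hμH : ∀ ζ : AlgebraicClosure (𝔮.adicCompletion K), (∀ τ ∈ H, τ • ζ = ζ) → ζ ^ p = 1 → ζ = 1 :=
    TateTorsionRigidity.fixed_pow_prime_eq_one_of_degree hpP H hμF
      fun x hx => TateTorsionRigidity.exists_natDegree_minpoly_eq_pow_of_fixed_ker f hsurj x hx
  -- the inertia group: fixes `t`, and `I = I^{p-1}·(I ∩ H)`
  have htI := SqrtGammaNonsplitFrobenius.inertia_fix_sqrt_gamma (W.baseChange K) hmult𝔮 t ht2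
  have hcop : Nat.Coprime (p - 1) p :=
    ((Nat.Prime.coprime_iff_not_dvd hpP).2 fun h => by
      have h1 := Nat.le_of_dvd (by have := hpP.two_le; omega) h
      have h2 := hpP.two_le
      omega).symm
  have hunit : IsUnit (((p - 1 : ℕ) : ℕ) : ℤ_[p]) :=
    PadicInt.isUnit_iff.mpr (PadicInt.norm_natCast_eq_one_iff.mpr hcop.symm)
  have hIdiv : ∀ σ ∈ absInertia (𝔮.adicCompletion K), ∃ σ₁ ∈ absInertia (𝔮.adicCompletion K),
      ∃ h ∈ absInertia (𝔮.adicCompletion K), h ∈ H ∧ σ = σ₁ ^ (p - 1) * h := fun σ hσ => by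
    obtain ⟨σ₁, hσ₁, h, hh, hfh, heq⟩ := exists_eq_pow_mul_of_mem_absInertia (𝔮.adicCompletion K) f hunit hσ
    exact ⟨σ₁, hσ₁, h, hh, (MonoidHom.mem_ker).2 hfh, heq⟩
  -- `q = r^{p^k}`, `r ∉ K_𝔮^p`
  obtain ⟨k, r, hrq, hr⟩ := exists_pow_eq_and_forall_pow_ne (p := p) 𝔮 hq0 hq1
  have hr0' : algebraMap (𝔮.adicCompletion K) (AlgebraicClosure (𝔮.adicCompletion K)) r ≠ 0 :=
    (map_ne_zero _).2 fun h0 => by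
      rw [h0, zero_pow (pow_ne_zero _ hpP.ne_zero)] at hrq
      exact hq0 hrq.symm
  -- the map on points and the finite target `ℤ·Ψ(r)`
  have hginj : Function.Injective (pointsMap (W.baseChange K) (𝔮.adicCompletion K)) := pointsMapOfEmb_injective _ _
  set R := Ψ (Additive.ofMul (Units.mk0 _ hr0')) with hR
  have hRtor : p ^ k • R = 0 := by
    rw [hR, ← map_nsmul, ← ofMul_pow]
    refine (hΨker _).2 ⟨1, ?_⟩
    rw [zpow_one, Units.val_pow_eq_pow_val]
    change (algebraMap _ _ r) ^ p ^ k = algebraMap _ _ q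
    rw [← map_pow, hrq]
  have hfo : IsOfFinAddOrder R := (isOfFinAddOrder_iff_nsmul_eq_zero).2 ⟨p ^ k, pow_pos hpP.pos k, hRtor⟩
  have hTfin : (AddSubgroup.zmultiples R : Set (localPoints (W.baseChange K) (𝔮.adicCompletion K))).Finite := by
    have hcard : Nat.card (AddSubgroup.zmultiples R) = addOrderOf R := Nat.card_zmultiples R
    haveI : Finite (AddSubgroup.zmultiples R) := Nat.finite_of_card_ne_zero (by rw [hcard]; exact hfo.addOrderOf_pos.ne')
    exact Set.toFinite _
  refine (hTfin.preimage hginj.injOn).subset ?_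
  rintro P ⟨hPtor, hPfix⟩
  have hQtor : ∃ n : ℕ, p ^ n • pointsMap (W.baseChange K) (𝔮.adicCompletion K) P = 0 :=
    hPtor.imp fun n hn => by rw [← map_nsmul, hn, map_zero]
  have hQfix : ∀ τ ∈ H, τ • pointsMap (W.baseChange K) (𝔮.adicCompletion K) P =
      pointsMap (W.baseChange K) (𝔮.adicCompletion K) P := fun τ hτ => by
    rw [← RibetGoodLattice.GreenbergVatsalReductionDatum.pointsMap_absGaloisRestrict_smul, hPfix τ hτ]
  exact mem_zmultiples_of_fixed_of_twisted hp2 H hμH (absInertia (𝔮.adicCompletion K)) hIdiv hμ hq0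
    (zpow_algebraMap_injective 𝔮 hq0 hq1) hrq hr htI Ψ hΨker hΨσ hr0' hQtor hQfix (hΨsurj _)

/-! ## §5 The (L1) shape on `E_K[p^∞]` and p748758's (hfin𝔮) / (hfinK) with `hsplit` replaced by `hmult` + (μ) -/

/-- **The (L1) shape at a multiplicative prime**: a FINITE `ℤ_p`-submodule `A₀ ≤ E_K[p^∞]` containing every vector fixed by `res h` for all
`h ∈ Γ_{K_𝔮}` with `f h = 1` (the shape of `LocalTorsionDegreeOne.exists_submodule_finite_of_fixed_primaryTorsion`, without the split
hypothesis and without the order bound). [cite: Castella2018Erratum, Lemma 2.1, Remark (2) (p. 2)] [cite: SilvermanATAEC1994, Thm. V.5.3, Cor. V.5.4] -/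
theorem exists_submodule_finite_of_fixed_primaryTorsion_of_mult (W : WeierstrassCurve ℚ) [W.IsElliptic] (hp2 : p ≠ 2)
    (hmult : W.HasMultiplicativeReductionAtPrime p) (𝔮 : HeightOneSpectrum (𝓞 K)) (h𝔮 : ((p : ℕ) : 𝓞 K) ∈ 𝔮.asIdeal)
    (he : 𝔮.asIdeal.ramificationIdx (𝓞 ℚ) = 1) (hf : 𝔮.asIdeal.inertiaDeg (𝓞 ℚ) = 1)
    (f : absoluteGaloisGroup (𝔮.adicCompletion K) →ₜ* Multiplicative ℤ_[p]) {s : ℕ}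
    (hsurj : ∀ y : ℤ_[p], ∃ σ : absoluteGaloisGroup (𝔮.adicCompletion K), (f σ).toAdd = (p : ℤ_[p]) ^ s * y)
    (hμ : ∀ ζ : AlgebraicClosure (𝔮.adicCompletion K),
      (∀ σ ∈ absInertia (𝔮.adicCompletion K), σ • ζ = ζ) → ζ ^ p = 1 → ζ = 1) :
    ∃ A₀ : Submodule ℤ_[p] (PrimaryTorsion (geomPoints (W.baseChange K)) p), Finite A₀ ∧
      ∀ a : PrimaryTorsion (geomPoints (W.baseChange K)) p,
        (∀ h : absoluteGaloisGroup (𝔮.adicCompletion K), f h = 1 →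
          absGaloisRestrict K (𝔮.adicCompletion K) h • a = a) → a ∈ A₀ := by
  have hfin := finite_fixed_torsion_of_mult W hp2 hmult 𝔮 h𝔮 he hf f hsurj hμ
  let A₀ : Submodule ℤ_[p] (PrimaryTorsion (geomPoints (W.baseChange K)) p) :=
    { carrier := {a | ∀ h : absoluteGaloisGroup (𝔮.adicCompletion K), f h = 1 →
        absGaloisRestrict K (𝔮.adicCompletion K) h • a = a}
      add_mem' := fun {a b} ha hb h hh => by rw [smul_add, ha h hh, hb h hh]
      zero_mem' := fun h _ => smul_zero _
      smul_mem' := fun c {a} ha h hh => by rw [smul_comm, ha h hh] }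
  have hval : ∀ a : A₀, ((a : PrimaryTorsion (geomPoints (W.baseChange K)) p) : geomPoints (W.baseChange K)) ∈
      {P : geomPoints (W.baseChange K) | (∃ n : ℕ, (p ^ n) • P = 0) ∧
        ∀ τ ∈ f.toMonoidHom.ker, absGaloisRestrict K (𝔮.adicCompletion K) τ • P = P} := fun a =>
    ⟨PrimaryTorsion.exists_pow_smul_eq_zero _, fun τ hτ => by
      have h := a.2 τ ((MonoidHom.mem_ker).1 hτ)
      exact congrArg PrimaryTorsion.val h⟩
  have hinj : Function.Injective fun a : A₀ =>
      (⟨_, hval a⟩ : {P : geomPoints (W.baseChange K) | (∃ n : ℕ, (p ^ n) • P = 0) ∧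
        ∀ τ ∈ f.toMonoidHom.ker, absGaloisRestrict K (𝔮.adicCompletion K) τ • P = P}) := by
    intro a b hab
    have h := congrArg Subtype.val hab
    exact Subtype.ext (PrimaryTorsion.ext h)
  haveI := hfin.to_subtype
  exact ⟨A₀, Finite.of_injective _ hinj, fun a ha => ha⟩

variable (W : WeierstrassCurve ℚ) [W.IsElliptic]
  {𝒪 : Type*} [CommRing 𝒪] [TopologicalSpace 𝒪]
  {A : Type} [AddCommGroup A] [Module 𝒪 A] [TopologicalSpace A]
  (κ : ZpExtension K p) (ρ : ContinuousRep (absoluteGaloisGroup K) 𝒪 A) (c : 𝒪)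
  (θ₀ : Submodule.torsionBy 𝒪 A c →+ PrimaryTorsion (geomPoints (W.baseChange K)) p)

/-- **(hfin𝔮) at a MULTIPLICATIVE prime, split or non-split**: p748758's `finite_fixed_torsionBy_local_of_splitMult` with
`W.HasSplitMultiplicativeReductionAtPrime p` replaced by `W.HasMultiplicativeReductionAtPrime p` + (μ). `p` odd, `𝔮 ∋ p` of degree one,
`κ(res Γ_{K_𝔮}) ⊇ p^s ℤ_p`, `θ₀ : A[c] → E_K[p^∞]` additive `Γ_K`-equivariant with finite kernel: the set
`{a ∈ A : c • a = 0, ρ(res τ) a = a for all τ ∈ Γ_{K_𝔮} with κ(res τ) = 1}` is FINITE.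
[cite: Castella2018Erratum, Lemma 2.1 and Remark (2) (p. 2)] [cite: SilvermanATAEC1994, Thm. V.5.3, Cor. V.5.4] -/
theorem finite_fixed_torsionBy_local_of_mult (hp2 : p ≠ 2) (hmult : W.HasMultiplicativeReductionAtPrime p)
    (𝔮 : HeightOneSpectrum (𝓞 K)) (h𝔮 : ((p : ℕ) : 𝓞 K) ∈ 𝔮.asIdeal)
    (he : 𝔮.asIdeal.ramificationIdx (𝓞 ℚ) = 1) (hf : 𝔮.asIdeal.inertiaDeg (𝓞 ℚ) = 1) {s : ℕ}
    (hsurj : ∀ y : ℤ_[p], ∃ τ : LocalGroup K (Sum.inl 𝔮), (κ (localMap K (Sum.inl 𝔮) τ)).toAdd = (p : ℤ_[p]) ^ s * y)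
    (hμ : ∀ ζ : AlgebraicClosure (𝔮.adicCompletion K),
      (∀ σ ∈ absInertia (𝔮.adicCompletion K), σ • ζ = ζ) → ζ ^ p = 1 → ζ = 1)
    (hθ : ∀ (σ : absoluteGaloisGroup K) (a : Submodule.torsionBy 𝒪 A c),
      θ₀ (BigGaloisRep.torsionRep ρ c σ a) = (W.baseChange K).primaryTorsionGaloisRep p σ (θ₀ a))
    (hker : Finite θ₀.ker) :
    Set.Finite {a : A | c • a = 0 ∧ ∀ τ : LocalGroup K (Sum.inl 𝔮),
      κ (localMap K (Sum.inl 𝔮) τ) = 1 → ρ (localMap K (Sum.inl 𝔮) τ) a = a} := by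
  let f : absoluteGaloisGroup (𝔮.adicCompletion K) →ₜ* Multiplicative ℤ_[p] :=
    κ.toContinuousMonoidHom.comp (absGaloisRestrict K (𝔮.adicCompletion K))
  have hsurjf : ∀ y : ℤ_[p], ∃ τ : absoluteGaloisGroup (𝔮.adicCompletion K), (f τ).toAdd = (p : ℤ_[p]) ^ s * y := hsurj
  obtain ⟨A₀, hA₀fin, hA₀⟩ :=
    exists_submodule_finite_of_fixed_primaryTorsion_of_mult W hp2 hmult 𝔮 h𝔮 he hf f hsurjf hμ
  haveI := hA₀fin
  refine TelescopeK2GlobalDefectInputs.finite_fixed_torsionBy_of_addMonoidHom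
    (κ.toContinuousMonoidHom.comp (localMap K (Sum.inl 𝔮))) (ρ.restrict (localMap K (Sum.inl 𝔮))) c
    (fun τ e => (W.baseChange K).primaryTorsionGaloisRep p (localMap K (Sum.inl 𝔮) τ) e) θ₀
    (fun τ a => ?_) hker ?_
  · have h := hθ (localMap K (Sum.inl 𝔮) τ) a
    have heq : BigGaloisRep.torsionRep (ρ.restrict (localMap K (Sum.inl 𝔮))) c τ a =
        BigGaloisRep.torsionRep ρ c (localMap K (Sum.inl 𝔮) τ) a := Subtype.ext rfl
    rw [heq]
    exact h
  · refine (Set.finite_coe_iff.mp (inferInstance : Finite A₀)).subset fun e he => ?_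
    exact hA₀ e fun h hh => by
      have h1 := he h hh
      rw [primaryTorsionGaloisRep_apply] at h1
      exact h1

/-- **(hfinK) at a multiplicative prime**: the `Gal(K̄/K_∞)`-fixed `c`-torsion of `A` is finite (p748758's
`finite_fixed_torsionBy_global_of_local` on `finite_fixed_torsionBy_local_of_mult`). [cite: GreenbergLNM1716, §4, proof of Prop. 4.10] -/
theorem finite_fixed_torsionBy_global_of_mult (hp2 : p ≠ 2) (hmult : W.HasMultiplicativeReductionAtPrime p)
    (𝔮 : HeightOneSpectrum (𝓞 K)) (h𝔮 : ((p : ℕ) : 𝓞 K) ∈ 𝔮.asIdeal)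
    (he : 𝔮.asIdeal.ramificationIdx (𝓞 ℚ) = 1) (hf : 𝔮.asIdeal.inertiaDeg (𝓞 ℚ) = 1) {s : ℕ}
    (hsurj : ∀ y : ℤ_[p], ∃ τ : LocalGroup K (Sum.inl 𝔮), (κ (localMap K (Sum.inl 𝔮) τ)).toAdd = (p : ℤ_[p]) ^ s * y)
    (hμ : ∀ ζ : AlgebraicClosure (𝔮.adicCompletion K),
      (∀ σ ∈ absInertia (𝔮.adicCompletion K), σ • ζ = ζ) → ζ ^ p = 1 → ζ = 1)
    (hθ : ∀ (σ : absoluteGaloisGroup K) (a : Submodule.torsionBy 𝒪 A c),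
      θ₀ (BigGaloisRep.torsionRep ρ c σ a) = (W.baseChange K).primaryTorsionGaloisRep p σ (θ₀ a))
    (hker : Finite θ₀.ker) :
    Set.Finite {a : A | c • a = 0 ∧ ∀ g : absoluteGaloisGroup K, κ g = 1 → ρ g a = a} :=
  TelescopeK2FixedTorsionFiniteSplitMult.finite_fixed_torsionBy_global_of_local κ ρ c 𝔮
    (finite_fixed_torsionBy_local_of_mult W κ ρ c θ₀ hp2 hmult 𝔮 h𝔮 he hf hsurj hμ hθ hker)

/-- **(hfin𝔮) at a multiplicative prime on the anticyclotomic tower** (`K` imaginary quadratic, `κ` anticyclotomic, `p` odd: the open image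
on `Γ_{K_𝔮}` is Brink's Cor. 1, tree `AnticyclotomicLocalImage.anticyclotomic_exists_forall_exists_toAdd_eq_pow_mul`).
[cite: Brink2007, Cor. 1 (p. 2136)] [cite: Castella2018Erratum, Lemma 2.1 and Remark (2) (p. 2)] -/
theorem finite_fixed_torsionBy_local_anticyclotomic_of_mult (hK : IsImaginaryQuadratic K) (hp2 : p ≠ 2)
    (hmult : W.HasMultiplicativeReductionAtPrime p) (hκ : κ.IsAnticyclotomic)
    (𝔮 : HeightOneSpectrum (𝓞 K)) (h𝔮 : ((p : ℕ) : 𝓞 K) ∈ 𝔮.asIdeal)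
    (he : 𝔮.asIdeal.ramificationIdx (𝓞 ℚ) = 1) (hf : 𝔮.asIdeal.inertiaDeg (𝓞 ℚ) = 1)
    (hμ : ∀ ζ : AlgebraicClosure (𝔮.adicCompletion K),
      (∀ σ ∈ absInertia (𝔮.adicCompletion K), σ • ζ = ζ) → ζ ^ p = 1 → ζ = 1)
    (hθ : ∀ (σ : absoluteGaloisGroup K) (a : Submodule.torsionBy 𝒪 A c),
      θ₀ (BigGaloisRep.torsionRep ρ c σ a) = (W.baseChange K).primaryTorsionGaloisRep p σ (θ₀ a))
    (hker : Finite θ₀.ker) :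
    Set.Finite {a : A | c • a = 0 ∧ ∀ τ : LocalGroup K (Sum.inl 𝔮),
      κ (localMap K (Sum.inl 𝔮) τ) = 1 → ρ (localMap K (Sum.inl 𝔮) τ) a = a} := by
  obtain ⟨s, hsurj⟩ := AnticyclotomicLocalImage.anticyclotomic_exists_forall_exists_toAdd_eq_pow_mul hK hp2 κ hκ 𝔮 h𝔮
  exact finite_fixed_torsionBy_local_of_mult W κ ρ c θ₀ hp2 hmult 𝔮 h𝔮 he hf hsurj hμ hθ hker

end Summit.BirchSwinnertonDyer.BirchSwinnertonDyer.Theorems.TelescopeK2FixedTorsionFiniteMult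

end
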